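import Summits.BirchSwinnertonDyer.BirchSwinnertonDyer.Theorems.SignedLowerHalvesSprungLowerDivisibilityAtThreeIotaDoorContraOrbit
import Summits.BirchSwinnertonDyer.BirchSwinnertonDyer.Theorems.SignedLowerHalvesSprungLowerDivisibilityAtThreeKatoSporadicLedgerOrbit
import Summits.BirchSwinnertonDyer.BirchSwinnertonDyer.Theorems.SignedLowerHalvesSprungLowerDivisibilityAtThreeIotaDoorContraClosedOfThm714
import Summits.BirchSwinnertonDyer.BirchSwinnertonDyer.Theorems.SignedLowerHalvesSprungLowerDivisibilityAtThreeStubPeriodMu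
import HarnessLib

/-!
# Crux `SprungLowerDivisibilityAtThree` (item stmt-BirchSwinnertonDyer-19875; twin route `PrintX8VSC`: cruxes K′ 23732 / C′ 23733), line
# `chromatic-common-zeros`: THE ORBIT FORM OF THE PRINT-KEYED `ι`-DOOR, part 4 — KATO'S THM. 13.4 ON THE CONTRAGREDIENT PACKAGE AT THE
# SAME PRIME (`x′ ≤ k`, no `ι`), the print-keyed ORBIT WINDOW `m ≤ k + k′` (so the door is EXACTLY `k + k′ = m`), and the Main Conjecture
# as an EQUALITY `k = x′` inside the door over the K′ binder telescope

Cell `bsd-ssimc` (host), width seat `cruxlead-stmt-BirchSwinnertonDyer-19875-w2` (gen 12) under the 19875 LEAD; `--supports`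
stmt-BirchSwinnertonDyer-19875 `--as helper`; theorems only (no `def`, no named fact, no instance); closes NO item. Sequel of
`…IotaDoorContraOrbit` (door(𝔭) ⟺ door(ι𝔭) ⟺ `k + k′ ≤ m`) and print-keyed twin of w2 g7's `…KatoSporadicLedgerKato` §2 / w3 g6's
`…KatoSporadicLedgerOrbit` §2. Notation at a height-one `𝔭 ∌ p`: joint contragredient package `I, Cs, Cf` (`Cs.Z = Cf.Z`), natural-keyed fine
datum `Y′ : FineSelmerDualData κ γ⁻¹`, `k = ℓ_𝔭(I.H ⧸ Cs.Z)`, `j = min_• ℓ_𝔭(Λ ⧸ range C•.colMap)`, `m = min_• ℓ_𝔭 Λ/(G•)`, `x′ = ℓ_𝔭 Y′.X`,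
`ι𝔭 = PrimeSpectrum.comap (invol p) 𝔭`, `k′ = k(ι𝔭)`.

* §1 `SharpFlatColemanKatoDataContra.exists_isEulerSystemClass_lengthAt_quotient_le_zeta` (an Euler-system class below the zeta index; the
  fields `image_zeta_localized`, `zeta_le_span`, `colMap` are common to both packages — same proof as the γ-keyed sibling) and
  **`SharpFlatColemanKatoDataContra.fine_le_zeta_of_thm13_4 (h134C) (hSerre)`: `x′(𝔭) ≤ k(𝔭)` off `(p)` AT THE SAME PRIME** — in print
  keying the natural-keyed fine dual `Y′` (key `γ⁻¹`) and the natural `𝐇¹` datum `I` pair without any `ι` (Kato 2004 Thm. 13.4 (2), print-exact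
  `thm13_4_lengthAt_fineSelmerDualContra_le_of_isEulerSystemClass`; hypothesis (v) from Serre's open image, `¬CM`).
* §2 `min_lengthAt_quotient_span_le_zeta_add_zeta_comap_invol_contra_of_thm13_4`: the print-keyed ORBIT WINDOW **`m(𝔭) ≤ k(𝔭) + k(ι𝔭)`**
  from F-α♮′ at `𝔭` (`j(𝔭) ≤ x′(ι𝔭)`, displayed — the conclusion of `cokerBoundIotaOffT_contra_of_poitouTate_of_thm714[']`) and §1 at `ι𝔭`;
  `iotaDoor_contra_iff_zeta_add_zeta_comap_invol_eq_of_thm13_4`: with `…IotaDoorContraOrbit` §2, **door ⟺ `k + k′ = m` EXACTLY**, residue ⟺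
  `m < k + k′`; `zeta_eq_fine_of_iotaDoor_contra_of_thm13_4`: **inside the door `k(𝔭) = x′(𝔭)`** (Kato 12.10 with BOTH inclusions at `𝔭`).
* §3 over the K′ binder telescope of item 23732 (print keying, X8, sporadic common zero): `zeta_eq_fine_sporadic_contra_of_iotaDoor_of_heldPack_of_thm714
  (hPT) (h124) (hMatar) (h714) (h3) (h134C) (hSerre)`: **door `k ≤ j(ι𝔭)` ⟹ `k(𝔭) = x′(𝔭)`** — on every sporadic common-zero `ι`-orbit
  outside the registered residue, Kato's Main Conjecture holds at `𝔭` as an EQUALITY (door half: LEAD g7's `iotaDoorContra_sporadic_of_heldPack_of_thm714`;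
  Kato half: §1 with the X8 discharges `p = 3 ≠ 2`, `¬CM` (`ClassX8.not_hasCM`), `E[3]` irreducible, normalised generators from `stub_periodMu h3`).

HONEST FRAMING: Kato's ⊇ half (a published theorem, typed statement-only as `h134C`; `hSerre` likewise) + bookkeeping; the Eisenstein half on
the residue (`stub_iotaResidueContra` / `stub_iotaResidueCyclotomicContra`), K′, C′, K1, leaf X8 and BSD are NOT proved here. CONDITIONAL on
the displayed named facts. WHAT IT SAYS: in print keying the K′ door/residue dichotomy is «`k + k′ = m`» / «`k + k′ > m`» on common-zero
`ι`-orbits, and the door case carries the FULL main conjecture at both members.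

References: [Kato2004Asterisque] Thm. 12.4–12.6 (pp. 221–222), Ex. 13.3 (p. 225), Thm. 13.4 (p. 226), Conj. 12.10 (p. 224), (17.13.1)
(pp. 279–280); [Sprung2012] Def. 6.1 (p. 1495), §7.1, Thm. 7.14 (3) (p. 1504), Main Conj. 7.21 (p. 1505); [Sprung2017] Thm. 4.13, Cor. 4.14;
[SerreAbelianLadic1968] IV-11; [Matar2020] Thm. 1.1; [Wingberg1989] Cor. 2.5; [GreenbergVatsal2000] §3 Rem. 3.4; tree: `…KatoSporadicLedgerKato`
(w2 g7), `…KatoSporadicLedgerOrbit` (w3 g6), `…IotaDoorContra` (w3 g9), `…IotaDoorContraClosedOfThm714` (LEAD g7), `…IotaDoorContraOrbit` (w2 g12),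
`Kato2004/EulerSystemBoundFineSelmerContragredient.lean`.
-/

set_option linter.dupNamespace false
set_option autoImplicit false

noncomputable section

open scoped Classical NumberField MatrixGroups ModularForm

open NumberField IsDedekindDomain CongruenceSubgroup WeierstrassCurve Field
  Literature.NumberTheory.EllipticCurves Literature.NumberTheory.EllipticCurves.ModularForms
  Literature.NumberTheory.EllipticCurves.ZpExtension Literature.NumberTheory.EllipticCurves.Sprung2017
  Literature.NumberTheory.EllipticCurves.Sprung2012 Literature.NumberTheory.EllipticCurves.Rank1Residual
  Literature.NumberTheory.EllipticCurves.IwasawaAlgebra Literature.NumberTheory.EllipticCurves.Kato2004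
  Literature.NumberTheory.EllipticCurves.Module
  Summit.BirchSwinnertonDyer.BirchSwinnertonDyer.Theorems
  Summit.BirchSwinnertonDyer.BirchSwinnertonDyer.Theorems.SmallImageSignedMuDefect
  Summit.BirchSwinnertonDyer.Rank1Residual.Supersingular

namespace Summit.BirchSwinnertonDyer.BirchSwinnertonDyer.Theorems.ChromaticCommonZeros

/-- `G ≠ 0` for a Néron-normalised `G` of a non-zero `L` with `ϖ ≠ 0` (private plumbing). [cite: Sprung2012, Def. 6.1 (p. 1495)] -/
private theorem normalised_ne_zero_orbitKato {p : ℕ} [Fact p.Prime] {ϖ : ℚ} (hϖ0 : ϖ ≠ 0) {L G : IwasawaAlgebra p} (hL : L ≠ 0)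
    (hG : iwasawaToPowerSeries p G = PowerSeries.C ((ϖ : ℚ) : ℚ_[p]) * iwasawaToPowerSeries p L) : G ≠ 0 := by
  intro h0
  rw [h0, map_zero, eq_comm, mul_eq_zero] at hG
  rcases hG with hC | hL'
  · have h1 : ((ϖ : ℚ) : ℚ_[p]) = 0 := by simpa using congrArg PowerSeries.constantCoeff hC
    exact hϖ0 (by exact_mod_cast h1)
  · exact hL (iwasawaToPowerSeries_injective p (by rw [hL', map_zero]))

/-! ### §1 Kato's Thm. 13.4 (2) on the contragredient package, at the SAME prime -/

section Package

variable (W : WeierstrassCurve ℚ) [W.IsElliptic] (p : ℕ) [Fact p.Prime]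
  [ContinuousSMul ℤ_[p] (W.tateModule p)] [Module.Free ℤ_[p] (W.tateModule p)]
  [Module.Finite ℤ_[p] (W.tateModule p)]
  {N : ℕ} {f : CuspForm (Gamma0 N) 2} {ϖ : ℚ} {κ : ZpExtension ℚ p} {γ : absoluteGaloisGroup ℚ}
  {E : Type} [Field E] [Algebra ℚ E] {ι : AlgebraicClosure ℚ →ₐ[ℚ] AlgebraicClosure E} {ap : ℤ}
  {g : absoluteGaloisGroup E} {c : ℕ → localPoints W E} {I : IwasawaH1Data W p κ γ}

/-- **An Euler-system class below the zeta index, contragredient package.** For a print-keyed ♯/♭ package `C` of colour `•` with `L^• ≠ 0`,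
`E[p]` irreducible, Néron-normalised `G₁ ≠ 0`, and a height-one `𝔭`: some GENUINE Euler-system class `s ≠ 0` has
`ℓ_𝔭(I.H ⧸ Λs) ≤ ℓ_𝔭(I.H ⧸ C.Z)`. Twin of `SharpFlatColemanKatoData.exists_isEulerSystemClass_lengthAt_quotient_le_zeta` (w2 g7) — same
proof, the fields `image_zeta_localized`, `zeta_le_span`, `colMap`, `colMap_injective` being common to both packages.
[cite: Kato2004Asterisque, Thm. 12.6 (p. 222), Ex. 13.3 (p. 225)] [cite: Sprung2012, Def. 6.1 (p. 1495), Thm. 7.14 (3) (p. 1504)] -/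
theorem _root_.Literature.NumberTheory.EllipticCurves.Sprung2012.SharpFlatColemanKatoDataContra.exists_isEulerSystemClass_lengthAt_quotient_le_zeta
    {col : Chroma} (C : SharpFlatColemanKatoDataContra W p f ϖ κ γ ι ap g c col I)
    (hirr : W.HasIrreducibleModPGaloisRep p) {Lsharp Lflat G₁ : IwasawaAlgebra p}
    (hSP : IsSprungPair f p ap Lsharp Lflat) (hcol : chromaticL col Lsharp Lflat ≠ 0)
    (hG₁ : iwasawaToPowerSeries p G₁ =
      PowerSeries.C ((ϖ : ℚ) : ℚ_[p]) * iwasawaToPowerSeries p (chromaticL col Lsharp Lflat))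
    (hG0 : G₁ ≠ 0) (𝔭 : PrimeSpectrum (IwasawaAlgebra p)) (h𝔭 : 𝔭.asIdeal.height = 1) :
    ∃ s : I.H, IsEulerSystemClass W p κ γ I s ∧ s ≠ 0 ∧
      Module.lengthAt (IwasawaAlgebra p) (I.H ⧸ Submodule.span (IwasawaAlgebra p) {s}) 𝔭 ≤
        Module.lengthAt (IwasawaAlgebra p) (I.H ⧸ C.Z) 𝔭 := by
  obtain ⟨s₁, hs₁, hs₁G, -⟩ := C.image_zeta_localized hirr Lsharp Lflat G₁ hSP hG₁ 𝔭 h𝔭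
  obtain ⟨z₀, hz₀Z, hz₀⟩ := Submodule.mem_map.mp hs₁G
  have hs₁0 : s₁ ≠ 0 := fun h0 => hs₁ (h0 ▸ 𝔭.asIdeal.zero_mem)
  have hc₀ : C.colMap z₀ ≠ 0 := by rw [hz₀]; exact mul_ne_zero hs₁0 hG0
  obtain ⟨s, hsS, hcs, hle⟩ :=
    exists_mem_lengthAt_quotient_span_le_of_mem_span C.colMap (C.zeta_le_span hz₀Z) hc₀ 𝔭 h𝔭
  have hs0 : s ≠ 0 := fun h0 => hcs (by rw [h0, map_zero])
  refine ⟨s, hsS, hs0, ?_⟩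
  -- `ℓ_𝔭 Λ/(Col z₀) = ℓ_𝔭 Λ/(s₁ G₁) = ℓ_𝔭 Λ/(G₁) = k + c`
  have hz₀len : Module.lengthAt (IwasawaAlgebra p) (IwasawaAlgebra p ⧸ Ideal.span {C.colMap z₀}) 𝔭 =
      Module.lengthAt (IwasawaAlgebra p) (I.H ⧸ C.Z) 𝔭 +
        Module.lengthAt (IwasawaAlgebra p) (IwasawaAlgebra p ⧸ LinearMap.range C.colMap) 𝔭 := by
    rw [hz₀, lengthAt_quotient_span_singleton_mul G₁ hs₁0 𝔭,
      lengthAt_quotient_eq_zero_of_not_le (by rwa [Ideal.span_singleton_le_iff_mem]), zero_add,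
      C.lengthAt_quotient_span_eq_zeta_add_range W p hirr hSP hcol hG₁ 𝔭 h𝔭]
  -- `ℓ_𝔭 Λ/(Col s) = ℓ_𝔭(I.H ⧸ Λs) + c`
  have hslen : Module.lengthAt (IwasawaAlgebra p) (IwasawaAlgebra p ⧸ Ideal.span {C.colMap s}) 𝔭 =
      Module.lengthAt (IwasawaAlgebra p) (I.H ⧸ Submodule.span (IwasawaAlgebra p) {s}) 𝔭 +
        Module.lengthAt (IwasawaAlgebra p) (IwasawaAlgebra p ⧸ LinearMap.range C.colMap) 𝔭 := by
    rw [← lengthAt_quotient_map_eq_add C.colMap (C.colMap_injective Lsharp Lflat hSP hcol) _ 𝔭,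
      Submodule.map_span, Set.image_singleton]
  -- cancel the finite local index `c`
  have hc : Module.lengthAt (IwasawaAlgebra p) (IwasawaAlgebra p ⧸ LinearMap.range C.colMap) 𝔭 ≠ ⊤ := by
    have hm : Module.lengthAt (IwasawaAlgebra p) (IwasawaAlgebra p ⧸ Ideal.span {C.colMap z₀}) 𝔭 ≠ ⊤ :=
      lengthAt_ne_top_of_isTorsionBy hc₀ (isTorsionBy_quotient_span_singleton (C.colMap z₀)) 𝔭 (le_of_eq h𝔭)
    rw [hz₀len] at hm
    exact fun htop => hm (by rw [htop, add_top])
  rw [hz₀len, hslen] at hle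
  exact (ENat.addLECancellable_of_ne_top hc).add_le_add_iff_right.mp hle

/-- **KATO'S THM. 13.4 (2) ON THE CONTRAGREDIENT PACKAGE, AT THE SAME PRIME: `x′(𝔭) ≤ k(𝔭)` off `(p)`.** For a print-keyed ♯/♭ package `C`
of colour `•` (`L^• ≠ 0`, `E[p]` irreducible, Néron-normalised `G₁ ≠ 0`) on a pinned `I` over the cyclotomic `(κ, γ)`, `p` odd, `E` non-CM,
and a NATURAL-keyed fine dual datum `Y′ : FineSelmerDualData κ γ⁻¹`: at every height-one `𝔭 ∌ p`, `ℓ_𝔭 Y′.X ≤ ℓ_𝔭(I.H ⧸ C.Z)`. In print keying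
no involution appears on Kato's side (it sits in Matar's dot, inside F-α♮′). Proof: §1's Euler-system class + Kato's Thm. 13.4 (2) for it,
hypothesis (v) from Serre's open image. CONDITIONAL on `h134C`, `hSerre` (displayed). [cite: Kato2004Asterisque, Thm. 12.5 (p. 222), Thm. 13.4 (2) (p. 226)]
[cite: SerreAbelianLadic1968, Ch. IV §2.2 (IV-11)] [cite: Sprung2012, Thm. 7.14 (3) (p. 1504)] -/
theorem _root_.Literature.NumberTheory.EllipticCurves.Sprung2012.SharpFlatColemanKatoDataContra.fine_le_zeta_of_thm13_4
    (h134C : thm13_4_lengthAt_fineSelmerDualContra_le_of_isEulerSystemClass)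
    (hSerre : serre_adicImage_contains_congruenceSubgroup)
    {col : Chroma} (C : SharpFlatColemanKatoDataContra W p f ϖ κ γ ι ap g c col I)
    (hp : p ≠ 2) (hκ : κ.IsCyclotomic) (hγ : κ.IsTopGenerator γ) (hCM : ¬ W.HasCM)
    (hirr : W.HasIrreducibleModPGaloisRep p) {Lsharp Lflat G₁ : IwasawaAlgebra p}
    (hSP : IsSprungPair f p ap Lsharp Lflat) (hcol : chromaticL col Lsharp Lflat ≠ 0)
    (hG₁ : iwasawaToPowerSeries p G₁ =
      PowerSeries.C ((ϖ : ℚ) : ℚ_[p]) * iwasawaToPowerSeries p (chromaticL col Lsharp Lflat))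
    (hG0 : G₁ ≠ 0) (Y : W.FineSelmerDualData κ γ⁻¹)
    (𝔭 : PrimeSpectrum (IwasawaAlgebra p)) (h𝔭 : 𝔭.asIdeal.height = 1)
    (hp𝔭 : (p : IwasawaAlgebra p) ∉ 𝔭.asIdeal) :
    Module.lengthAt (IwasawaAlgebra p) Y.X 𝔭 ≤ Module.lengthAt (IwasawaAlgebra p) (I.H ⧸ C.Z) 𝔭 := by
  obtain ⟨s, hsES, hs0, hle⟩ := C.exists_isEulerSystemClass_lengthAt_quotient_le_zeta W p hirr hSP hcol hG₁ hG0 𝔭 h𝔭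
  obtain ⟨n, hn⟩ := hSerre W p hCM
  have hV := exists_finrank_quotient_range_sub_one_eq_one_of_forall_congruence W p n hn
  have hp𝔭' : PowerSeries.C (p : ℤ_[p]) ∉ 𝔭.asIdeal := by rwa [map_natCast]
  exact ((h134C W p κ γ hp hκ hγ I Y s hsES hs0 hV).1 𝔭 h𝔭 hp𝔭').trans hle

/-! ### §2 The print-keyed orbit window, the door as an equality, and MC equality inside the door -/

/-- **THE PRINT-KEYED ORBIT WINDOW `m(𝔭) ≤ k(𝔭) + k(ι𝔭)`.** Joint contragredient package at a height-one `𝔭 ∌ p`, both colours non-zero and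
normalised, `E[p]` irreducible, `p` odd, `¬CM`, natural-keyed `Y′`; DISPLAYED: (hFα) F-α♮′ at `𝔭`, `j(𝔭) ≤ x′(ι𝔭)` (the conclusion of
`cokerBoundIotaOffT_contra_of_poitouTate_of_thm714[']`). THEN `min(ℓ_𝔭 Λ/(Gs), ℓ_𝔭 Λ/(Gf)) ≤ k(𝔭) + k(ι𝔭)`: `m = k + j ≤ k + x′(ι𝔭) ≤ k + k(ι𝔭)`
(§1 at `ι𝔭`). CONDITIONAL on `h134C`, `hSerre`. [cite: Kato2004Asterisque, Thm. 13.4 (p. 226), (17.13.1) (p. 280)] [cite: Sprung2012, §7.1, Props. 7.3/7.6]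
[cite: Matar2020, Thm. 1.1] [cite: Wingberg1989, Cor. 2.5] -/
theorem min_lengthAt_quotient_span_le_zeta_add_zeta_comap_invol_contra_of_thm13_4
    (h134C : thm13_4_lengthAt_fineSelmerDualContra_le_of_isEulerSystemClass)
    (hSerre : serre_adicImage_contains_congruenceSubgroup)
    (Cs : SharpFlatColemanKatoDataContra W p f ϖ κ γ ι ap g c Chroma.sharp I)
    (Cf : SharpFlatColemanKatoDataContra W p f ϖ κ γ ι ap g c Chroma.flat I) (hZ : Cs.Z = Cf.Z)
    (hp : p ≠ 2) (hκ : κ.IsCyclotomic) (hγ : κ.IsTopGenerator γ) (hCM : ¬ W.HasCM)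
    (hirr : W.HasIrreducibleModPGaloisRep p) {Lsharp Lflat Gs Gf : IwasawaAlgebra p}
    (hSP : IsSprungPair f p ap Lsharp Lflat) (hs : chromaticL Chroma.sharp Lsharp Lflat ≠ 0)
    (hfl : chromaticL Chroma.flat Lsharp Lflat ≠ 0)
    (hGs : iwasawaToPowerSeries p Gs =
      PowerSeries.C ((ϖ : ℚ) : ℚ_[p]) * iwasawaToPowerSeries p (chromaticL Chroma.sharp Lsharp Lflat))
    (hGf : iwasawaToPowerSeries p Gf =
      PowerSeries.C ((ϖ : ℚ) : ℚ_[p]) * iwasawaToPowerSeries p (chromaticL Chroma.flat Lsharp Lflat))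
    (hGs0 : Gs ≠ 0) (Y : W.FineSelmerDualData κ γ⁻¹)
    (𝔭 : PrimeSpectrum (IwasawaAlgebra p)) (h𝔭 : 𝔭.asIdeal.height = 1)
    (hp𝔭 : (p : IwasawaAlgebra p) ∉ 𝔭.asIdeal)
    (hFα : min (Module.lengthAt (IwasawaAlgebra p) (IwasawaAlgebra p ⧸ LinearMap.range Cs.colMap) 𝔭)
        (Module.lengthAt (IwasawaAlgebra p) (IwasawaAlgebra p ⧸ LinearMap.range Cf.colMap) 𝔭) ≤
      Module.lengthAt (IwasawaAlgebra p) Y.X (PrimeSpectrum.comap (invol p).toRingHom 𝔭)) :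
    min (Module.lengthAt (IwasawaAlgebra p) (IwasawaAlgebra p ⧸ Ideal.span {Gs}) 𝔭)
        (Module.lengthAt (IwasawaAlgebra p) (IwasawaAlgebra p ⧸ Ideal.span {Gf}) 𝔭) ≤
      Module.lengthAt (IwasawaAlgebra p) (I.H ⧸ Cs.Z) 𝔭 +
        Module.lengthAt (IwasawaAlgebra p) (I.H ⧸ Cs.Z) (PrimeSpectrum.comap (invol p).toRingHom 𝔭) := by
  obtain ⟨h𝔮, hp𝔮⟩ := comap_invol_heightOne_not_mem 𝔭 h𝔭 hp𝔭
  have hKato := Cs.fine_le_zeta_of_thm13_4 W p h134C hSerre hp hκ hγ hCM hirr hSP hs hGs hGs0 Y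
    (PrimeSpectrum.comap (invol p).toRingHom 𝔭) h𝔮 hp𝔮
  rw [min_lengthAt_quotient_span_eq_zeta_add_localIndex_contra W p Cs Cf hZ hirr hSP hs hfl hGs hGf 𝔭 h𝔭]
  gcongr
  exact hFα.trans hKato

/-- **THE DOOR IS EXACTLY `k + k′ = m` (print keying).** In the situation of the window theorem, with `(L♯, L♭)` `ι`-stable and `ϖ ≠ 0` displayed:
`k(𝔭) ≤ j(ι𝔭) ↔ k(𝔭) + k(ι𝔭) = m(𝔭)` — the door `k + k′ ≤ m` of `iotaDoor_contra_iff_zeta_add_zeta_comap_invol_le` meets the window `m ≤ k + k′`.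
So the registered residue `j(ι𝔭) < k(𝔭)` is EXACTLY `m < k + k′` and the door EXACTLY the orbits balancing Kato's zeta index against the
common-zero multiplicity. CONDITIONAL on `h134C`, `hSerre`. [cite: Kato2004Asterisque, Conj. 12.10 (p. 224), Thm. 13.4 (p. 226)]
[cite: Sprung2012, Def. 6.1, §7.1, Thm. 7.14 (3)] [cite: GreenbergLNM1716, §1] -/
theorem iotaDoor_contra_iff_zeta_add_zeta_comap_invol_eq_of_thm13_4
    (h134C : thm13_4_lengthAt_fineSelmerDualContra_le_of_isEulerSystemClass)
    (hSerre : serre_adicImage_contains_congruenceSubgroup)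
    (Cs : SharpFlatColemanKatoDataContra W p f ϖ κ γ ι ap g c Chroma.sharp I)
    (Cf : SharpFlatColemanKatoDataContra W p f ϖ κ γ ι ap g c Chroma.flat I) (hZ : Cs.Z = Cf.Z)
    (hp : p ≠ 2) (hκ : κ.IsCyclotomic) (hγ : κ.IsTopGenerator γ) (hCM : ¬ W.HasCM)
    (hirr : W.HasIrreducibleModPGaloisRep p) (hϖ : ϖ ≠ 0) {Lsharp Lflat Gs Gf : IwasawaAlgebra p}
    (hSP : IsSprungPair f p ap Lsharp Lflat) (hs0 : Lsharp ≠ 0) (hf0 : Lflat ≠ 0)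
    (hGs : iwasawaToPowerSeries p Gs =
      PowerSeries.C ((ϖ : ℚ) : ℚ_[p]) * iwasawaToPowerSeries p (chromaticL Chroma.sharp Lsharp Lflat))
    (hGf : iwasawaToPowerSeries p Gf =
      PowerSeries.C ((ϖ : ℚ) : ℚ_[p]) * iwasawaToPowerSeries p (chromaticL Chroma.flat Lsharp Lflat))
    (hJ : ∀ x ∈ Ideal.span ({Lsharp, Lflat} : Set (IwasawaAlgebra p)),
      invol p x ∈ Ideal.span ({Lsharp, Lflat} : Set (IwasawaAlgebra p)))
    (Y : W.FineSelmerDualData κ γ⁻¹) (𝔭 : PrimeSpectrum (IwasawaAlgebra p)) (h𝔭 : 𝔭.asIdeal.height = 1)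
    (hp𝔭 : (p : IwasawaAlgebra p) ∉ 𝔭.asIdeal)
    (hFα : min (Module.lengthAt (IwasawaAlgebra p) (IwasawaAlgebra p ⧸ LinearMap.range Cs.colMap) 𝔭)
        (Module.lengthAt (IwasawaAlgebra p) (IwasawaAlgebra p ⧸ LinearMap.range Cf.colMap) 𝔭) ≤
      Module.lengthAt (IwasawaAlgebra p) Y.X (PrimeSpectrum.comap (invol p).toRingHom 𝔭)) :
    Module.lengthAt (IwasawaAlgebra p) (I.H ⧸ Cs.Z) 𝔭 ≤
        min (Module.lengthAt (IwasawaAlgebra p) (IwasawaAlgebra p ⧸ LinearMap.range Cs.colMap)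
            (PrimeSpectrum.comap (invol p).toRingHom 𝔭))
          (Module.lengthAt (IwasawaAlgebra p) (IwasawaAlgebra p ⧸ LinearMap.range Cf.colMap)
            (PrimeSpectrum.comap (invol p).toRingHom 𝔭)) ↔
      Module.lengthAt (IwasawaAlgebra p) (I.H ⧸ Cs.Z) 𝔭 +
          Module.lengthAt (IwasawaAlgebra p) (I.H ⧸ Cs.Z) (PrimeSpectrum.comap (invol p).toRingHom 𝔭) =
        min (Module.lengthAt (IwasawaAlgebra p) (IwasawaAlgebra p ⧸ Ideal.span {Gs}) 𝔭)
          (Module.lengthAt (IwasawaAlgebra p) (IwasawaAlgebra p ⧸ Ideal.span {Gf}) 𝔭) := by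
  have hs : chromaticL Chroma.sharp Lsharp Lflat ≠ 0 := by rwa [chromaticL_sharp]
  have hfl : chromaticL Chroma.flat Lsharp Lflat ≠ 0 := by rwa [chromaticL_flat]
  have hGs0 : Gs ≠ 0 := normalised_ne_zero_orbitKato hϖ hs hGs
  have hwin := min_lengthAt_quotient_span_le_zeta_add_zeta_comap_invol_contra_of_thm13_4 W p h134C hSerre Cs Cf hZ hp hκ hγ hCM
    hirr hSP hs hfl hGs hGf hGs0 Y 𝔭 h𝔭 hp𝔭 hFα
  rw [iotaDoor_contra_iff_zeta_add_zeta_comap_invol_le W p Cs Cf hZ hirr hϖ hSP hs0 hf0 hGs hGf hJ 𝔭 h𝔭 hp𝔭]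
  exact ⟨fun hle => le_antisymm hle hwin, fun heq => heq.le⟩

/-- **INSIDE THE DOOR, `k(𝔭) = x′(𝔭)` (print keying; Kato 12.10 with both inclusions at `𝔭`).** Contragredient joint package, both colours non-zero,
`E[p]` irreducible, `p` odd, `¬CM`, Néron-normalised `Gs ≠ 0`, natural-keyed `Y′`, height-one `𝔭 ∌ p` and a height-one `𝔮` (in the line `𝔮 = ι𝔭`);
DISPLAYED (hFα) F-α♮′ at `𝔮` towards `𝔭` and (hdoor) `k(𝔭) ≤ j(𝔮)`. THEN `k(𝔭) = x′(𝔭)`: `≤` is the door (`katoFineLowerAt_of_iotaDoor_contra`), `≥` is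
§1. CONDITIONAL on `h134C`, `hSerre`. [cite: Kato2004Asterisque, Conj. 12.10 (p. 224), Thm. 13.4 (p. 226), (17.13.1) (p. 280)]
[cite: Sprung2012, §7.1, Thm. 7.14 (3), Main Conj. 7.21 (p. 1505)] [cite: Matar2020, Thm. 1.1] -/
theorem zeta_eq_fine_of_iotaDoor_contra_of_thm13_4
    (h134C : thm13_4_lengthAt_fineSelmerDualContra_le_of_isEulerSystemClass)
    (hSerre : serre_adicImage_contains_congruenceSubgroup)
    (Cs : SharpFlatColemanKatoDataContra W p f ϖ κ γ ι ap g c Chroma.sharp I)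
    (Cf : SharpFlatColemanKatoDataContra W p f ϖ κ γ ι ap g c Chroma.flat I)
    (hp : p ≠ 2) (hκ : κ.IsCyclotomic) (hγ : κ.IsTopGenerator γ) (hCM : ¬ W.HasCM)
    (hirr : W.HasIrreducibleModPGaloisRep p) {Lsharp Lflat Gs : IwasawaAlgebra p}
    (hSP : IsSprungPair f p ap Lsharp Lflat) (hs : chromaticL Chroma.sharp Lsharp Lflat ≠ 0)
    (hfl : chromaticL Chroma.flat Lsharp Lflat ≠ 0)
    (hGs : iwasawaToPowerSeries p Gs =
      PowerSeries.C ((ϖ : ℚ) : ℚ_[p]) * iwasawaToPowerSeries p (chromaticL Chroma.sharp Lsharp Lflat))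
    (hGs0 : Gs ≠ 0) (Y : W.FineSelmerDualData κ γ⁻¹)
    (𝔭 𝔮 : PrimeSpectrum (IwasawaAlgebra p)) (h𝔭 : 𝔭.asIdeal.height = 1)
    (hp𝔭 : (p : IwasawaAlgebra p) ∉ 𝔭.asIdeal) (h𝔮 : 𝔮.asIdeal.height = 1)
    (hFα : (∀ (col' : Chroma) (G' : IwasawaAlgebra p),
        iwasawaToPowerSeries p G' =
          PowerSeries.C ((ϖ : ℚ) : ℚ_[p]) * iwasawaToPowerSeries p (chromaticL col' Lsharp Lflat) →
        G' ∈ 𝔮.asIdeal) →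
      min (Module.lengthAt (IwasawaAlgebra p) (IwasawaAlgebra p ⧸ LinearMap.range Cs.colMap) 𝔮)
          (Module.lengthAt (IwasawaAlgebra p) (IwasawaAlgebra p ⧸ LinearMap.range Cf.colMap) 𝔮) ≤
        Module.lengthAt (IwasawaAlgebra p) Y.X 𝔭)
    (hdoor : Module.lengthAt (IwasawaAlgebra p) (I.H ⧸ Cs.Z) 𝔭 ≤
      min (Module.lengthAt (IwasawaAlgebra p) (IwasawaAlgebra p ⧸ LinearMap.range Cs.colMap) 𝔮)
          (Module.lengthAt (IwasawaAlgebra p) (IwasawaAlgebra p ⧸ LinearMap.range Cf.colMap) 𝔮)) :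
    Module.lengthAt (IwasawaAlgebra p) (I.H ⧸ Cs.Z) 𝔭 = Module.lengthAt (IwasawaAlgebra p) Y.X 𝔭 :=
  le_antisymm (katoFineLowerAt_of_iotaDoor_contra W p Cs Cf hirr hSP hs hfl Y 𝔭 𝔮 h𝔮 hFα hdoor)
    (Cs.fine_le_zeta_of_thm13_4 W p h134C hSerre hp hκ hγ hCM hirr hSP hs hGs hGs0 Y 𝔭 h𝔭 hp𝔭)

end Package

/-! ### §3 Over the K′ binder telescope (X8, print keying): inside the door the Main Conjecture is an equality at `𝔭` -/

/-- **INSIDE THE DOOR, `k(𝔭) = x′(𝔭)` OVER THE K′ BINDER TELESCOPE** (the registered skeleton of item 23732, LEAD g7): from the born ι-door pack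
(PT functional model `hPT`, Kato 12.4 `h124`, Matar 1.1 `hMatar`), Sprung Thm. 7.14 `h714`, the period unit `h3`, Kato's Thm. 13.4 print-exact
`h134C` and Serre's open image `hSerre`: at every sporadic common zero `𝔭` of an X8 pair with `k(𝔭) ≤ j(ι𝔭)` (INSIDE the door),
**`ℓ_𝔭(I.H ⧸ Cs.Z) = ℓ_𝔭 Y′.X`** — Kato's Main Conjecture 12.10 at `𝔭` with BOTH inclusions. Door half: `iotaDoorContra_sporadic_of_heldPack_of_thm714`;
Kato half: `SharpFlatColemanKatoDataContra.fine_le_zeta_of_thm13_4` with the X8 discharges (`p = 3 ≠ 2`, `ClassX8.not_hasCM`, `E[3]` irreducible,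
both colours non-zero, normalised generators from `stub_periodMu h3`). CONDITIONAL on the seven displayed named facts (published theorems typed
statement-only). [cite: Kato2004Asterisque, Thm. 12.4 (p. 221), Conj. 12.10 (p. 224), Thm. 13.4 (p. 226), (17.13.1) (pp. 279–280)]
[cite: Sprung2012, Thm. 7.14 (3) (p. 1504), Main Conj. 7.21 (p. 1505)] [cite: Matar2020, Thm. 1.1] [cite: GreenbergVatsal2000, §3, Remark 3.4]
[cite: SerreAbelianLadic1968, Ch. IV §2.2 (IV-11)] -/
theorem zeta_eq_fine_sporadic_contra_of_iotaDoor_of_heldPack_of_thm714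
    (hPT : thm714seq_sharpFlat_poitouTate_functionalModel) (h124 : Kato2004.thm12_4)
    (hMatar : matar2020_thm11_selmerDualTorsion_pseudoIso_fineSelmerDual) (h714 : thm714_sharpFlatSelmerDual_finite_torsion)
    (h3 : realPeriodRat_eq_unit_mul_plusPeriod_three)
    (h134C : thm13_4_lengthAt_fineSelmerDualContra_le_of_isEulerSystemClass)
    (hSerre : serre_adicImage_contains_congruenceSubgroup) :
    ∀ (W : WeierstrassCurve ℚ) [W.IsElliptic] [W.IsGloballyMinimal] (p : ℕ) [Fact p.Prime]
      [ContinuousSMul ℤ_[p] (W.tateModule p)] [Module.Free ℤ_[p] (W.tateModule p)]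
      [Module.Finite ℤ_[p] (W.tateModule p)],
      ClassX8 W p → ∀ (κ : ZpExtension ℚ p) (γ : Field.absoluteGaloisGroup ℚ),
      κ.IsCyclotomic → κ.IsTopGenerator γ → IsCyclotomicVariable p γ →
    ∀ (v : HeightOneSpectrum (𝓞 ℚ)), (p : 𝓞 ℚ) ∈ v.asIdeal →
    ∀ (g : Field.absoluteGaloisGroup (v.adicCompletion ℚ)),
      κ.IsTopGenerator (resGalOfEmb (closureEmb (K := ℚ) (v.adicCompletion ℚ)) g) →
    ∀ (cneg : localPoints W (v.adicCompletion ℚ)) (c : ℕ → localPoints W (v.adicCompletion ℚ)),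
      IsHondaSystem κ (closureEmb (K := ℚ) (v.adicCompletion ℚ)) W (W.frobeniusTrace p) g cneg c →
    ∀ (N : ℕ) (_ : NeZero N) (f : CuspForm (Gamma0 N) 2) (ϖ : ℚ) (Lsharp Lflat : IwasawaAlgebra p),
      IsNewformOf W f → (ϖ : ℝ) * W.realPeriodRat = plusPeriod f →
      IsSprungPair f p (W.frobeniusTrace p) Lsharp Lflat →
    ∀ (I : Kato2004.IwasawaH1Data W p κ γ)
      (Cs : SharpFlatColemanKatoDataContra W p f ϖ κ γ (closureEmb (K := ℚ) (v.adicCompletion ℚ))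
        (W.frobeniusTrace p) g c Chroma.sharp I)
      (Cf : SharpFlatColemanKatoDataContra W p f ϖ κ γ (closureEmb (K := ℚ) (v.adicCompletion ℚ))
        (W.frobeniusTrace p) g c Chroma.flat I),
      Cs.Z = Cf.Z →
    ∀ (Y : W.FineSelmerDualData κ γ⁻¹) (𝔭 : PrimeSpectrum (IwasawaAlgebra p)), 𝔭.asIdeal.height = 1 →
      (p : IwasawaAlgebra p) ∉ 𝔭.asIdeal →
      (¬ ∃ n : ℕ, ((cyclotomicOmega p n).map (Int.castRingHom ℤ_[p]) : PowerSeries ℤ_[p]) ∈ 𝔭.asIdeal) →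
      (∀ (col' : Chroma) (G' : IwasawaAlgebra p),
        iwasawaToPowerSeries p G' =
          PowerSeries.C (ϖ : ℚ_[p]) * iwasawaToPowerSeries p (chromaticL col' Lsharp Lflat) →
        G' ∈ 𝔭.asIdeal) →
      Module.lengthAt (IwasawaAlgebra p) (I.H ⧸ Cs.Z) 𝔭 ≤
          min (Module.lengthAt (IwasawaAlgebra p) (IwasawaAlgebra p ⧸ LinearMap.range Cs.colMap)
                (PrimeSpectrum.comap (invol p).toRingHom 𝔭))
            (Module.lengthAt (IwasawaAlgebra p) (IwasawaAlgebra p ⧸ LinearMap.range Cf.colMap)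
                (PrimeSpectrum.comap (invol p).toRingHom 𝔭)) →
      Module.lengthAt (IwasawaAlgebra p) (I.H ⧸ Cs.Z) 𝔭 = Module.lengthAt (IwasawaAlgebra p) Y.X 𝔭 := by
  intro W _ _ p _ _ _ _ hX κ γ hκ hγ hcv v hv g hg cneg c hH N hN f ϖ Lsharp Lflat hf hϖ hSP I Cs Cf hZ Y 𝔭 h𝔭 hp𝔭
    hspor hcommon hdoor
  haveI : NeZero N := hN
  have hp2 : p ≠ 2 := by rw [hX.1]; decide
  have hs : chromaticL Chroma.sharp Lsharp Lflat ≠ 0 :=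
    ChromaticBothColours.ClassX8.chromaticL_ne_zero W p hX f Lsharp Lflat hf hSP Chroma.sharp
  obtain ⟨hG, -⟩ := stub_periodMu h3 W p hX N hN f ϖ Lsharp Lflat hf hϖ hSP
  obtain ⟨Gs, hGs⟩ := hG Chroma.sharp
  have hGs0 : Gs ≠ 0 := normalised_ne_zero_orbitKato (hf.periodRatio_ne_zero hϖ) hs hGs
  refine le_antisymm
    (iotaDoorContra_sporadic_of_heldPack_of_thm714 hPT h124 hMatar h714 W p hX κ γ hκ hγ hcv v hv g hg cneg c hH N hN f ϖ
      Lsharp Lflat hf hϖ hSP I Cs Cf hZ Y 𝔭 h𝔭 hp𝔭 hspor hcommon hdoor) ?_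
  exact Cs.fine_le_zeta_of_thm13_4 W p h134C hSerre hp2 hκ hγ (ClassX8.not_hasCM W p hX) (ClassX8.irr' W p hX) hSP hs hGs
    hGs0 Y 𝔭 h𝔭 hp𝔭

end Summit.BirchSwinnertonDyer.BirchSwinnertonDyer.Theorems.ChromaticCommonZeros

end
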